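import Literature.NumberTheory.Automorphic.IntegralWeightHeckeModuleGL2
import HarnessLib

/-!
# The ordinary line of `Sym^m`: the `X₁^m`-coefficient functional under upper-triangular matrices

Topic `NumberTheory/Automorphic`; namespace `Literature.NumberTheory.Automorphic.IntegralWeightGL2`;
theorems only.  Proof file supporting the named fact
`Literature.NumberTheory.Automorphic.hidaControl_dominantOrdinaryPoint` (Hida's control theorem):
the coefficient-module algebra behind **independence of weight** ([KhareThorne2017, §6.4,
Prop. 6.13]; [Hida1994AIF, §2, Prop. 2.1]) in the conventions of the tree's integral
"coefficients at `p`" model (`IntegralWeightHeckeModuleGL2`: `SymPow 𝒪 m = Sym^m(𝒪²)` = forms of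
degree `m` in `X₀, X₁`, acted on by ALL `2 × 2` matrices through the linear substitution
`linSubst A : X_i ↦ ∑_j A_{ji} X_j`, sections `f(gu) = u_p⁻¹ f(g)`).

For the upper-triangular Iwahori levels of the tree (`IwahoriCond.lower`: entries below the
diagonal are small) and the Hecke element `t_{v,1} = diag(ϖ_v, 1)`, the operator `U_v` is computed
with the representatives `(ϖ j; 0 1)`, which CONTRACT `Sym^m` onto the line of `X₁^m`: the
`U_v`-ordinary line is the LOWEST-weight line and the relevant functional is
`λ₁ = ` coefficient of `X₁^m` (as re-derived in the refutation notes of crux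
`ProModularOrdinaryClassical`, §5 (ii): "the `Iw_v`-invariant functional is the coefficient of
`e₁^{k−2}`, fixed by the representatives `(ϖ j; 0 1)`").  We prove, over any commutative ring `R`
(intended: `𝒪/ϖ^r`) and for homogeneous `P` of degree `m`:

* `killX₀_eq_coeff_smul` — killing `X₀` leaves `λ₁(P) · X₁^m`;
* `coeff_linSubst_of_lowerLeft_eq_zero` — **`λ₁` is an eigenfunctional of the upper-triangular
  matrices**: `λ₁(A · P) = A₁₁^m λ₁(P)` whenever `A₁₀ = 0` (so `λ₁ ∘ f` has the diamond character
  `diag(t₀,t₁) ↦ t₁^m`, slot `1`, and is invariant under `Iw_v(c,c)` modulo `ϖ^c`);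
* `linSubst_eq_coeff_smul_of_col_zero` — **a matrix whose first column vanishes (the reduction of
  `(ϖ^r j; 0 1)` modulo `ϖ^r`) factors through `λ₁`**: `A · P = λ₁(P) · (A · X₁^m)`, and
  `λ₁(A · X₁^m) = A₁₁^m` (`coeff_linSubst_X_one_pow`); in particular such `A` kill `ker λ₁`
  (`linSubst_eq_zero_of_col_zero_of_coeff_eq_zero`) — the mechanism "`U(c,c)` acts trivially on the
  image of `λ(α_p^r) g_j⁻¹` modulo `ϖ^r`" of the proof of [KhareThorne2017, Prop. 6.13], transposed
  to cochains;
* `linSubst_X_zero_pow_of_lowerLeft_eq_zero` — the highest-weight vector `X₀^m` spans a line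
  stable under the upper-triangular matrices (`A · X₀^m = A₀₀^m X₀^m`).

## References

* C. Khare, J. A. Thorne, *Potential automorphy and the Leopoldt conjecture*, Amer. J. Math. 139
  (2017), §6.4, Prop. 6.13 and its proof (arXiv:1409.7007, held; read 2026-08-16). [KhareThorne2017]
* H. Hida, *p-adic ordinary Hecke algebras for GL(2)*, Ann. Inst. Fourier 44 (1994), §2, Prop. 2.1
  (held). [Hida1994AIF]
-/

noncomputable section

open MvPolynomial Literature.Computability.AlgebraicComplexity

namespace Literature.NumberTheory.Automorphic.IntegralWeightGL2

variable {R : Type*} [CommRing R]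

/-! ### Killing `X₀` -/

/-- A homogeneous exponent vector of degree `m` in two variables with no `X₀` is `X₁^m`. [folklore] -/
theorem finsupp_eq_single_one_of_apply_zero_eq_zero {m : ℕ} {s : Fin 2 →₀ ℕ} (hs : s.degree = m)
    (h0 : s 0 = 0) : s = Finsupp.single 1 m := by
  ext i
  rw [Finsupp.degree_eq_sum, Fin.sum_univ_two, h0, zero_add] at hs
  fin_cases i
  · simp [h0]
  · simp [hs]

/-- **Killing `X₀` in a form of degree `m` leaves `λ₁(P) · X₁^m`**, `λ₁ = ` the coefficient of `X₁^m`: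
`P(0, X₁) = coeff_{X₁^m}(P) X₁^m`. [folklore] -/
theorem killX₀_eq_coeff_smul {m : ℕ} {P : MvPolynomial (Fin 2) R} (hP : P.IsHomogeneous m) :
    aeval (fun i : Fin 2 => if i = 0 then (0 : MvPolynomial (Fin 2) R) else X 1) P =
      coeff (Finsupp.single 1 m) P • (X 1 ^ m : MvPolynomial (Fin 2) R) := by
  classical
  conv_lhs => rw [P.as_sum]
  rw [map_sum]
  have hterm : ∀ s ∈ P.support, aeval (fun i : Fin 2 => if i = 0 then (0 : MvPolynomial (Fin 2) R) else X 1)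
      (monomial s (coeff s P)) =
      if s = Finsupp.single 1 m then coeff (Finsupp.single 1 m) P • (X 1 ^ m : MvPolynomial (Fin 2) R)
      else 0 := by
    intro s hs
    rw [aeval_monomial, Finsupp.prod_fintype _ _ (fun i => by simp), Fin.prod_univ_two]
    simp only [Fin.isValue, ↓reduceIte, one_ne_zero]
    by_cases h0 : s 0 = 0
    · have hdeg : s.degree = m := by
        by_contra hne
        exact (mem_support_iff.1 hs) (hP.coeff_eq_zero hne)
      have hs1 := finsupp_eq_single_one_of_apply_zero_eq_zero hdeg h0
      subst hs1
      simp [Algebra.smul_def]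
    · rw [zero_pow h0, zero_mul, mul_zero, if_neg]
      rintro rfl
      simp at h0
  rw [Finset.sum_congr rfl hterm, Finset.sum_ite_eq' P.support (Finsupp.single 1 m)
    (fun _ => coeff (Finsupp.single 1 m) P • (X 1 ^ m : MvPolynomial (Fin 2) R))]
  split_ifs with hmem
  · rfl
  · rw [notMem_support_iff.1 hmem, zero_smul]

/-! ### `λ₁` is an eigenfunctional of the upper-triangular matrices -/

/-- For `A` with `A₁₀ = 0`, killing `X₀` after substituting by `A` is rescaling by `A₁₁` after killing
`X₀` (both algebra maps agree on `X₀`, `X₁`). [folklore] -/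
theorem killX₀_comp_linSubst_of_lowerLeft_eq_zero {A : Matrix (Fin 2) (Fin 2) R} (hA : A 1 0 = 0) :
    (aeval fun i : Fin 2 => if i = 0 then (0 : MvPolynomial (Fin 2) R) else X 1).comp (linSubst (Fin 2) R A) =
      (aeval fun i : Fin 2 => A 1 1 • (X i : MvPolynomial (Fin 2) R)).comp
        (aeval fun i : Fin 2 => if i = 0 then (0 : MvPolynomial (Fin 2) R) else X 1) := by
  refine algHom_ext fun i => ?_
  fin_cases i <;> simp [linSubst_X, Fin.sum_univ_two, hA]

/-- **`λ₁(A · P) = A₁₁^m · λ₁(P)` for `A₁₀ = 0`** (`P` homogeneous of degree `m`, `λ₁ = coeff_{X₁^m}`):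
the coefficient of `X₁^m` is an eigenfunctional of every upper-triangular matrix, with eigencharacter
`A ↦ A₁₁^m` (slot `1`). [cite: KhareThorne2017, §6.4, proof of Prop. 6.13] -/
theorem coeff_linSubst_of_lowerLeft_eq_zero {m : ℕ} {A : Matrix (Fin 2) (Fin 2) R} (hA : A 1 0 = 0)
    {P : MvPolynomial (Fin 2) R} (hP : P.IsHomogeneous m) :
    coeff (Finsupp.single 1 m) (linSubst (Fin 2) R A P) = A 1 1 ^ m * coeff (Finsupp.single 1 m) P := by
  have hQ : (linSubst (Fin 2) R A P).IsHomogeneous m := linSubst_isHomogeneous A hP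
  have h1 := killX₀_eq_coeff_smul hQ
  have h2 : aeval (fun i : Fin 2 => if i = 0 then (0 : MvPolynomial (Fin 2) R) else X 1)
      (linSubst (Fin 2) R A P) = (A 1 1 ^ m * coeff (Finsupp.single 1 m) P) • (X 1 ^ m : MvPolynomial (Fin 2) R) := by
    have h := congrArg (fun φ => φ P) (killX₀_comp_linSubst_of_lowerLeft_eq_zero hA)
    simp only [AlgHom.comp_apply] at h
    rw [h, killX₀_eq_coeff_smul hP, map_smul, map_pow, aeval_X, smul_pow, smul_smul, mul_comm,
      ← smul_eq_mul (A 1 1 ^ m), smul_assoc]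
  have h3 := h1.symm.trans h2
  -- compare coefficients of `X₁^m`
  have h4 := congrArg (coeff (Finsupp.single 1 m)) h3
  simpa [X_pow_eq_monomial, coeff_monomial] using h4

/-- **The highest-weight vector `X₀^m` spans a line stable under the upper-triangular matrices**:
`A · X₀^m = A₀₀^m X₀^m` for `A₁₀ = 0`. [folklore] -/
theorem linSubst_X_zero_pow_of_lowerLeft_eq_zero {A : Matrix (Fin 2) (Fin 2) R} (hA : A 1 0 = 0) (m : ℕ) :
    linSubst (Fin 2) R A (X 0 ^ m) = A 0 0 ^ m • (X 0 ^ m : MvPolynomial (Fin 2) R) := by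
  rw [map_pow, linSubst_X, Fin.sum_univ_two, hA, zero_smul, add_zero, smul_pow]

/-! ### Matrices with vanishing first column factor through `λ₁` -/

/-- For `A` with vanishing first column, substitution by `A` kills `X₀`, hence factors through killing
`X₀`. [folklore] -/
theorem linSubst_comp_killX₀_of_col_zero {A : Matrix (Fin 2) (Fin 2) R} (h00 : A 0 0 = 0) (h10 : A 1 0 = 0) :
    (linSubst (Fin 2) R A).comp (aeval fun i : Fin 2 => if i = 0 then (0 : MvPolynomial (Fin 2) R) else X 1) =
      linSubst (Fin 2) R A := by
  refine algHom_ext fun i => ?_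
  fin_cases i <;> simp [linSubst_X, Fin.sum_univ_two, h00, h10]

/-- **`A · P = λ₁(P) · (A · X₁^m)` when the first column of `A` vanishes** (`P` homogeneous of degree
`m`) — the reductions modulo `ϖ^r` of the representatives `(ϖ^r j; 0 1)` of `U_v^r` see only the
`X₁^m`-coefficient. [cite: KhareThorne2017, §6.4, proof of Prop. 6.13] -/
theorem linSubst_eq_coeff_smul_of_col_zero {m : ℕ} {A : Matrix (Fin 2) (Fin 2) R} (h00 : A 0 0 = 0)
    (h10 : A 1 0 = 0) {P : MvPolynomial (Fin 2) R} (hP : P.IsHomogeneous m) :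
    linSubst (Fin 2) R A P = coeff (Finsupp.single 1 m) P • linSubst (Fin 2) R A (X 1 ^ m) := by
  have h := congrArg (fun φ => φ P) (linSubst_comp_killX₀_of_col_zero h00 h10)
  simp only [AlgHom.comp_apply] at h
  rw [← h, killX₀_eq_coeff_smul hP, map_smul]

/-- In particular such matrices kill `ker λ₁`. [folklore] -/
theorem linSubst_eq_zero_of_col_zero_of_coeff_eq_zero {m : ℕ} {A : Matrix (Fin 2) (Fin 2) R}
    (h00 : A 0 0 = 0) (h10 : A 1 0 = 0) {P : MvPolynomial (Fin 2) R} (hP : P.IsHomogeneous m)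
    (hl : coeff (Finsupp.single 1 m) P = 0) : linSubst (Fin 2) R A P = 0 := by
  rw [linSubst_eq_coeff_smul_of_col_zero h00 h10 hP, hl, zero_smul]

/-- `λ₁(A · X₁^m) = A₁₁^m` for `A₁₀ = 0` (e.g. `= 1` for the representatives `(ϖ^r j; 0 1)`). [folklore] -/
theorem coeff_linSubst_X_one_pow {A : Matrix (Fin 2) (Fin 2) R} (hA : A 1 0 = 0) (m : ℕ) :
    coeff (Finsupp.single 1 m) (linSubst (Fin 2) R A (X 1 ^ m)) = A 1 1 ^ m := by
  rw [coeff_linSubst_of_lowerLeft_eq_zero hA (isHomogeneous_X_pow 1 m), X_pow_eq_monomial, coeff_monomial,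
    if_pos rfl, mul_one]

/-! ### The same statements on `Sym^m = SymPow R m` -/

section SymPow

variable {S : Type} [CommRing S]

/-- **`λ₁` is an eigenfunctional on `Sym^m`**: for `A₁₀ = 0`,
`coeff_{X₁^m}(symPowAction A P) = A₁₁^m coeff_{X₁^m}(P)`. [cite: KhareThorne2017, §6.4, proof of Prop. 6.13] -/
theorem coeff_symPowAction_of_lowerLeft_eq_zero {m : ℕ} {A : Matrix (Fin 2) (Fin 2) S} (hA : A 1 0 = 0)
    (P : SymPow S m) :
    coeff (Finsupp.single 1 m) ((symPowAction S m A P : SymPow S m) : MvPolynomial (Fin 2) S) =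
      A 1 1 ^ m * coeff (Finsupp.single 1 m) (P : MvPolynomial (Fin 2) S) := by
  rw [coe_symPowAction_apply]
  exact coeff_linSubst_of_lowerLeft_eq_zero hA ((mem_homogeneousSubmodule _ _).1 P.2)

/-- **On `Sym^m`, a matrix with vanishing first column factors through `λ₁`.**
[cite: KhareThorne2017, §6.4, proof of Prop. 6.13] -/
theorem coe_symPowAction_eq_coeff_smul_of_col_zero {m : ℕ} {A : Matrix (Fin 2) (Fin 2) S} (h00 : A 0 0 = 0)
    (h10 : A 1 0 = 0) (P : SymPow S m) :
    ((symPowAction S m A P : SymPow S m) : MvPolynomial (Fin 2) S) =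
      coeff (Finsupp.single 1 m) (P : MvPolynomial (Fin 2) S) • linSubst (Fin 2) S A (X 1 ^ m) := by
  rw [coe_symPowAction_apply]
  exact linSubst_eq_coeff_smul_of_col_zero h00 h10 ((mem_homogeneousSubmodule _ _).1 P.2)

end SymPow

end Literature.NumberTheory.Automorphic.IntegralWeightGL2
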